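import Literature.Probability.LatticeModels.ThermodynamicLimit
import HarnessLib

/-!
# The free and the plus graph of a box `Λ_L ⊂ ℤ^d`

Topic `Probability/LatticeModels`, namespace `Literature.Probability.LatticeModels.BoxGraphs`
(grouping sub-namespace named after the object: the two graphs of the box `Λ_L`).

The pure graph vocabulary of the box `Λ_L = box d L ⊂ ℤ^d` on which the finite-volume random
currents of the Ising model live (free and `+` boundary condition), in an **import-light** module
(project imports: `LatticeGraph`, `ThermodynamicLimit` only), so that statements about box
currents — `Current (BoxGraphs.free d L)`, `doubleCurrentMeasure (BoxGraphs.free 3 L) β A B`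
(`RandomCurrents.lean`), … — can be made without importing the Gibbs-state /
correlation-inequality cone of `DoubleCurrents.lean`.

* `BoxGraphs.Vertex d L = ↥Λ_{L+1}` — the common vertex type: the box `Λ_L` together with its
  outer vertex boundary (and a few isolated corner vertices of `Λ_{L+1}`);
* `BoxGraphs.free d L` — nearest-neighbour bonds with both endpoints in `Λ_L` (`ℰ_{Λ_L}`, the
  free system; ADS15 §2.1, (2.7));
* `BoxGraphs.plus d L` — nearest-neighbour bonds with at least one endpoint in `Λ_L`
  (`ℰ^b_{Λ_L}`), the ghost-free form of the `+` boundary condition of ADS15 §2.1, (2.8): the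
  ghost bond `{x,δ}` of coupling `J_{x,δ} = #{y ∉ Λ_L : y ∼ x}` is resolved into the unit bonds
  `{x,y}`, `y` a frozen boundary vertex (as in Duminil-Copin, *Lectures on the Ising and Potts
  models on the hypercubic lattice*, arXiv:1707.00520, §4.3);
* their `DecidableRel … .Adj` instances (needed for `edgeFinset`, hence for `Current`), the
  unfolding lemmas `BoxGraphs.free_adj`, `BoxGraphs.plus_adj`, the comparison
  `BoxGraphs.free_le_plus` (`ℰ_{Λ_L} ⊆ ℰ^b_{Λ_L}`) and `BoxGraphs.plus_le_comap_zdGraph` (both are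
  subgraphs of `ℤ^d` pulled back to `↥Λ_{L+1}`).

Source: M. Aizenman, H. Duminil-Copin, V. Sidoravicius, *Random currents and continuity of Ising
model's spontaneous magnetization*, Comm. Math. Phys. **334** (2015) 719–742, §2.1 (bib key
`AizenmanDuminilCopinSidoraviciusCMP2015`, "ADS15"; equation numbers of arXiv:1311.1937v3).

## Relation to `DoubleCurrents.lean` (design note)

These are, verbatim, the definitions introduced in `DoubleCurrents.lean` as
`BoxVertex` / `freeBoxGraph` / `plusBoxGraph` (with `freeBoxGraph_adj`, `plusBoxGraph_adj`,
`freeBoxGraph_le_plusBoxGraph`), whose import closure is heavy (`MagnetizationContinuity`,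
`GKSInequalities`, …). A literal move of those fully-qualified names into this module is not
expressible through single-file proposals (a name is indexed for one module; removing a name that
importers reference is refused), so this module is the import-light **home** of the notion under
the grouped names `BoxGraphs.*`, and the `DoubleCurrents.lean` names are kept there as
definitional aliases of these (`freeBoxGraph d L` unfolds to `BoxGraphs.free d L`; every existing
user compiles unchanged). TODO(operator dedup): fold the alias pairs
`BoxVertex ↦ BoxGraphs.Vertex`, `freeBoxGraph ↦ BoxGraphs.free`, `plusBoxGraph ↦ BoxGraphs.plus`
when a multi-file maintenance change is convenient.

Deliberately NOT here: currents, weights, the double-current laws, `exitConn`, `boxCore`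
(`RandomCurrents.lean`, `DoubleCurrents.lean`, `CurrentsEdgeAvoidance.lean`); anything
measure-theoretic; no `@[simp]` attributes (the lemmas are definitional unfoldings, used by `rw`).

## Mathlib status

`zdGraph d` is Mathlib's `SimpleGraph.hasse (Fin d → ℤ)` (`LatticeGraph.lean`). The two box
graphs are plain `SimpleGraph` structures on the subtype `↥(box d (L+1))` — not
`SimpleGraph.induce` / `Subgraph.coe`, so that both live on the SAME vertex type and
`BoxGraphs.free d L ≤ BoxGraphs.plus d L` typechecks; `SimpleGraph.comap Subtype.val (zdGraph d)`
is the induced graph of `Λ_{L+1}`, of which both are subgraphs (`plus_le_comap_zdGraph`).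
-/

noncomputable section

namespace Literature.Probability.LatticeModels

namespace BoxGraphs

variable (d : ℕ)

/-! ### The two finite graphs carrying the free and the plus currents of the box `Λ_L` -/

/-- The vertex type `↥Λ_{L+1}` (the box `Λ_L` together with its outer vertex boundary, and a
few isolated corner vertices) on which both currents of the box `Λ_L` live. [cite: AizenmanDuminilCopinSidoraviciusCMP2015, §2.1] -/
abbrev Vertex (L : ℕ) : Type := ↥(box d (L + 1))

/-- The graph of the **free** system in `Λ_L`: nearest-neighbour bonds with both endpoints in
`Λ_L` (`ℰ_{Λ_L}`; ADS15 §2.1, currents on `Ω_{Λ_L}` for (2.7)). [cite: AizenmanDuminilCopinSidoraviciusCMP2015, §2.1, eq. (2.7)] -/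
def free (L : ℕ) : SimpleGraph (Vertex d L) where
  Adj a b := (zdGraph d).Adj a.1 b.1 ∧ (a : Site d) ∈ box d L ∧ (b : Site d) ∈ box d L
  symm := ⟨fun _ _ h => ⟨h.1.symm, h.2.2, h.2.1⟩⟩
  loopless := ⟨fun _ h => h.1.ne rfl⟩

/-- The graph of the **plus** system in `Λ_L`: nearest-neighbour bonds with at least one
endpoint in `Λ_L` (`ℰ^b_{Λ_L}`), the other endpoint possibly a frozen boundary vertex of
`∂ᵉˣΛ_L ⊂ Λ_{L+1}` (the ghost-free form of ADS15 §2.1, (2.8): the ghost bond `{x,δ}` of coupling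
`J_{x,δ} = #{y ∉ Λ_L : y ∼ x}` is resolved into the unit bonds `{x,y}`). [cite: AizenmanDuminilCopinSidoraviciusCMP2015, §2.1, eq. (2.8)] -/
def plus (L : ℕ) : SimpleGraph (Vertex d L) where
  Adj a b := (zdGraph d).Adj a.1 b.1 ∧ ((a : Site d) ∈ box d L ∨ (b : Site d) ∈ box d L)
  symm := ⟨fun _ _ h => ⟨h.1.symm, h.2.symm⟩⟩
  loopless := ⟨fun _ h => h.1.ne rfl⟩

/-- Adjacency in the free box graph is decidable (needed for `edgeFinset`, hence for the
tree's `Current`). [folklore] -/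
instance instDecidableRelFreeAdj (L : ℕ) : DecidableRel (free d L).Adj := fun _ _ =>
  inferInstanceAs (Decidable (_ ∧ _))

/-- Adjacency in the plus box graph is decidable. [folklore] -/
instance instDecidableRelPlusAdj (L : ℕ) : DecidableRel (plus d L).Adj := fun _ _ =>
  inferInstanceAs (Decidable (_ ∧ _))

/-- Adjacency in the free box graph, unfolded. [cite: AizenmanDuminilCopinSidoraviciusCMP2015, §2.1, eq. (2.7)] -/
theorem free_adj {L : ℕ} (a b : Vertex d L) :
    (free d L).Adj a b ↔
      (zdGraph d).Adj a.1 b.1 ∧ (a : Site d) ∈ box d L ∧ (b : Site d) ∈ box d L :=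
  Iff.rfl

/-- Adjacency in the plus box graph, unfolded. [cite: AizenmanDuminilCopinSidoraviciusCMP2015, §2.1, eq. (2.8)] -/
theorem plus_adj {L : ℕ} (a b : Vertex d L) :
    (plus d L).Adj a b ↔
      (zdGraph d).Adj a.1 b.1 ∧ ((a : Site d) ∈ box d L ∨ (b : Site d) ∈ box d L) :=
  Iff.rfl

/-- The free bonds are plus bonds: `ℰ_{Λ_L} ⊆ ℰ^b_{Λ_L}`. [cite: AizenmanDuminilCopinSidoraviciusCMP2015, §2.1] -/
theorem free_le_plus (L : ℕ) : free d L ≤ plus d L :=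
  fun _ _ h => ⟨h.1, Or.inl h.2.1⟩

/-- The plus bonds are bonds of `ℤ^d`: `ℰ^b_{Λ_L} ⊆ ℰ_{ℤ^d}` read on the vertex type `↥Λ_{L+1}`,
i.e. `plus d L` is a subgraph of the graph induced by `ℤ^d` on `Λ_{L+1}`. [cite: AizenmanDuminilCopinSidoraviciusCMP2015, §2.1] -/
theorem plus_le_comap_zdGraph (L : ℕ) : plus d L ≤ (zdGraph d).comap Subtype.val :=
  fun _ _ h => h.1

end BoxGraphs

end Literature.Probability.LatticeModels

end
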